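import Summits.HodgeConjecture.HodgeConjecture.Theorems.VHCAbelianSchemesRoadNowhereDisplaceableDefs
import Literature.AlgebraicGeometry.Motives.AbelianVarietyBlochFiltrationTransfer
import Literature.NumberTheory.Transcendental.AnalytificationConnected
import Mathlib.AlgebraicGeometry.Morphisms.QuasiFinite
import Mathlib.AlgebraicGeometry.Morphisms.Proper
import HarnessLib

/-!
# Road №4 (`VHCAbelianSchemesRoad`), crux stmt-HodgeConjecture-26512 `DiagLocalOfMarkmanPinnedForall` — lens line N′ «nowhere-displaceable»,
# brick (N-I) `properJump_of_confinedLifts`: CONFINED LIFTS GIVE A PROPER JUMP DOWNSTAIRS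

research route conditional on HC_CM; not a corollary; Q11.4-sentence-2 already refuted in dim ≥ 3.

THE STATEMENT (VERBATIM the registered-shape stub (N-I) `stub_properJump_of_confinedLifts` of
`Cruxes/DiagLocalOfMarkmanPinnedForall/Lines/NowhereDisplaceable.lean` c9299650b742f1b3 l.283, over the re-homed constants of
`…Theorems.VHCAbelianSchemesRoadNowhereDisplaceableDefs`): for a secant–quotient datum `D` (`q : J × Ĵ → Y = (J × Ĵ)∕Ḡ` the quotient
isogeny), a complex `E•` on `Y`, and a closed subscheme `ι : V ↪ J × Ĵ` with `V(ℂ) ≠ (J × Ĵ)(ℂ)` such that every `p ∈ (J × Ĵ)(ℂ)` over a jump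
point of `E•` is `1` or lies in `V(ℂ)`, the Ext-jump locus of `E•` off `1` lies in the `ℂ`-points of a PROPER closed subscheme of `Y`
(`ProperJump D.Y E•`).

PROOF (scheme API only; no `Ḡ`-saturation, no dimension theory). Take `W := im(ι ≫ q) ↪ Y`, the scheme-theoretic image of the FINITE
morphism `ι ≫ q` (Mathlib `Scheme.Hom.image ∕ imageι ∕ toImage`); its points are `closure (q(ι(|V|))) = q(ι(|V|))` (`Scheme.Hom.support_ker`,
finite ⇒ closed map).
* `J(E•) ⊆ {1} ∪ W(ℂ)`: `q` is onto on `ℂ`-points (`AbelianVariety.pointsMap_surjective`), so a jump point is `q(p)`; by hypothesis `p = 1`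
  (and `q(1) = 1`) or `p = ι(v)`, and then `q(p) = j(toImage(v)) ∈ W(ℂ)`.
* `W(ℂ) ≠ Y(ℂ)`: if `W(ℂ) = Y(ℂ)` then every closed point of `Y` lies in the closed set `|W|` (closed points of a finite-type `ℂ`-scheme are
  the `ℂ`-points, `ComplexPoints.equivClosedPoints`), hence `|W| = |Y|` (`Y` is Jacobson, `closure_closedPoints`), so the generic point
  `η_Y = q(ι v)` for some `v ∈ |V|`; but `q(η_P) = η_Y` (`q` onto) and the fibre `q⁻¹(η_Y)` of the finite `q` is DISCRETE
  (`Scheme.Hom.isDiscrete_preimage_singleton`) while `η_P ⤳ ι v`, so `ι v = η_P`; the closed set `ι(|V|)` contains the generic point of the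
  integral `J × Ĵ`, so `ι` is onto, hence an isomorphism (`isIso_of_isClosedImmersion_of_surjective`, `J × Ĵ` reduced), and `V(ℂ) = (J × Ĵ)(ℂ)` —
  contradiction.

Everything is proved; no `sorry`, no named fact, standard axioms. NOTHING here says (N-F), (N-U), (S4) `stub_properJumpCarrierExists_End`,
the crux, №4, HC_AV, HC_CM or HC holds; HC_CM HELD, by name only. References: [cite: MumfordAV1970, §7 Thm. 4 (p. 72)]
[cite: GortzWedhorn2020, §12.13 (3) and Prop. 12.58 (p. 434)] [cite: Mukai1978, §3].
-/

noncomputable section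

open CategoryTheory CategoryTheory.Limits AlgebraicGeometry Topology

universe u

namespace Summit.HodgeConjecture.HodgeConjecture.Ring2.SemiregularRepresentatives

set_option linter.dupNamespace false -- the cell's namespace repeats the summit name, as in every `Ring2*` file

namespace NowhereDisplaceable

open Literature.AlgebraicGeometry Literature.AlgebraicGeometry.Motives Literature.AlgebraicGeometry.Motives.AbelianVariety
open Summit.HodgeConjecture.HodgeConjecture.Ring2.SemiregularRepresentatives.MoverTrap

/-! ## §1 Scheme lemmas: the only point of `P` over the generic point of `Y` along a finite surjection of integral schemes -/

section Schemes

/-- In a discrete subset no point specialises to a different point of the subset. [folklore] -/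
theorem eq_of_specializes_of_isDiscrete {X : Type*} [TopologicalSpace X] {s : Set X} (hs : IsDiscrete s)
    {a b : X} (ha : a ∈ s) (hb : b ∈ s) (h : a ⤳ b) : a = b := by
  obtain ⟨u, hu, hus⟩ := isDiscrete_iff_forall_mem_exists_isOpen.1 hs b hb
  have hbu : b ∈ u ∩ s := by rw [hus]; exact Set.mem_singleton b
  have hau : a ∈ u ∩ s := ⟨h.mem_open hu hbu.1, ha⟩
  rw [hus] at hau
  exact hau

/-- A surjective morphism of integral schemes maps the generic point to the generic point. [cite: GortzWedhorn2020, §12.13 (3)] -/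
theorem apply_genericPoint_eq_of_surjective {P Y : Scheme.{u}} (q : P ⟶ Y) [Surjective q] [IsIntegral P] [IsIntegral Y] :
    q (genericPoint P) = genericPoint Y := by
  have h := (genericPoint_spec P).image q.continuous
  rw [Set.image_univ, q.surjective.range_eq, closure_univ] at h
  exact h.eq (genericPoint_spec Y)

/-- **Along a FINITE surjection `q : P → Y` of integral schemes the only point of `P` over the generic point of `Y` is the generic point of `P`**
(the fibre `q⁻¹(η_Y)` is discrete and `η_P` specialises to each of its points). [cite: GortzWedhorn2020, Prop. 12.58 (p. 434)] -/
theorem eq_genericPoint_of_apply_eq_genericPoint {P Y : Scheme.{u}} (q : P ⟶ Y) [IsFinite q] [Surjective q]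
    [IsIntegral P] [IsIntegral Y] {x : P} (hx : q x = genericPoint Y) : x = genericPoint P := by
  have hη : genericPoint P ∈ q ⁻¹' {genericPoint Y} := by
    rw [Set.mem_preimage, Set.mem_singleton_iff, apply_genericPoint_eq_of_surjective]
  have hx' : x ∈ q ⁻¹' {genericPoint Y} := by
    rw [Set.mem_preimage, Set.mem_singleton_iff, hx]
  exact (eq_of_specializes_of_isDiscrete (q.isDiscrete_preimage_singleton (genericPoint Y)) hη hx'
    (genericPoint_specializes x)).symm

/-- **A closed subscheme `ι : V ↪ P` whose scheme-theoretic image `im(ι ≫ q) ↪ Y` under a FINITE surjection `q : P → Y` of integral schemes is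
all of `Y` is all of `P`**: `q(ι(|V|))` is closed (finite ⇒ closed map) and dense, so it contains `η_Y = q(ι v)`; then `ι v = η_P`
(`eq_genericPoint_of_apply_eq_genericPoint`) lies in the closed set `ι(|V|)`, which is therefore everything. [cite: GortzWedhorn2020, Prop. 12.58 (p. 434)] -/
theorem surjective_of_surjective_imageι_comp {V P Y : Scheme.{u}} (ι : V ⟶ P) [IsClosedImmersion ι]
    (q : P ⟶ Y) [IsFinite q] [Surjective q] [IsIntegral P] [IsIntegral Y]
    (h : Function.Surjective (ι ≫ q).imageι) : Function.Surjective ι := by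
  -- the set image of `ι ≫ q` is closed with closure `|im(ι ≫ q)| = |Y|`, hence it is `|Y|`
  have hrange : Set.range (ι ≫ q) = Set.univ := by
    have h1 : Set.range (ι ≫ q).ker.subschemeι = Set.univ := h.range_eq
    rw [Scheme.IdealSheafData.range_subschemeι, Scheme.Hom.support_ker] at h1
    rwa [(ι ≫ q).isClosedMap.isClosed_range.closure_eq] at h1
  obtain ⟨v, hv⟩ := (Set.range_eq_univ.1 hrange) (genericPoint Y)
  have hv' : ι v = genericPoint P :=
    eq_genericPoint_of_apply_eq_genericPoint q (x := ι v) (by rw [← Scheme.Hom.comp_apply]; exact hv)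
  -- `ι(|V|)` is closed and contains the generic point of `P`
  have hcl : IsClosed (Set.range ι) := ι.isClosedEmbedding.isClosed_range
  have huniv : Set.univ ⊆ Set.range ι := ((genericPoint_spec P).mem_closed_set_iff hcl).1 ⟨v, hv'⟩
  exact Set.range_eq_univ.1 (Set.eq_univ_of_univ_subset huniv)

end Schemes

/-! ## §2 The brick (N-I) -/

/-- **(N-I) — CONFINED LIFTS GIVE A PROPER JUMP DOWNSTAIRS** (VERBATIM the line's stub `stub_properJump_of_confinedLifts`, workfile
c9299650b742f1b3 l.283, over `…NowhereDisplaceableDefs`): if every `p ∈ (J × Ĵ)(ℂ)` over a jump point of `E•` is `1` or lies in `V(ℂ)` for a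
closed `V ↪ J × Ĵ` with `V(ℂ) ≠ (J × Ĵ)(ℂ)`, then `ProperJump Y E•` — witnessed by the scheme-theoretic image `im(ι ≫ q) ↪ Y` of the finite
`ι ≫ q`: `J(E) ⊆ {1} ∪ im(ℂ)` because `q` is onto on `ℂ`-points, and `im(ℂ) ≠ Y(ℂ)` because otherwise `|im| = |Y|` (closed points are dense),
`η_Y = q(ι v)` forces `ι v = η_{J × Ĵ}` (discrete fibre of the finite `q`), so `ι` is onto, hence an isomorphism onto the reduced `J × Ĵ`, and
`V(ℂ) = (J × Ĵ)(ℂ)`. [cite: MumfordAV1970, §7 Thm. 4 (p. 72)] [cite: GortzWedhorn2020, §12.13 (3) and Prop. 12.58 (p. 434)] -/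
theorem properJump_of_confinedLifts :
    ∀ (D : SecantQuotientDatum) (E : CochainComplex D.Y.X.left.Modules ℤ)
      (V : SchemeOver ℂ) (ι : V ⟶ D.P.X), IsClosedImmersion ι.left →
      Set.range (AlgPoints.map (L := ℂ) ι) ≠ Set.univ →
      (∀ p : D.P.Points ℂ, AlgPoints.map D.q.hom.hom.hom p ∈ extJumpLocus D.Y E → p = 1 ∨ p ∈ Set.range (AlgPoints.map (L := ℂ) ι)) →
      ProperJump D.Y E := by
  intro D E V ι hι hV hconf
  haveI : Surjective (Hom.toSchemeHom D.q) := D.isIsogeny_q.1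
  haveI : IsFinite (Hom.toSchemeHom D.q) := D.isIsogeny_q.2
  -- the finite morphism `f = q ∘ ι : V → Y`, its scheme-theoretic image `W ↪ Y` as a `ℂ`-scheme, and the `ℂ`-points it receives from `V`
  set f : V.left ⟶ D.Y.X.left := ι.left ≫ Hom.toSchemeHom D.q with hf
  have hqY : Hom.toSchemeHom D.q ≫ D.Y.X.hom = D.P.X.hom := Over.w D.q.hom.hom.hom
  let W : SchemeOver ℂ := Over.mk (f.imageι ≫ D.Y.X.hom)
  let j : W ⟶ D.Y.X := Over.homMk f.imageι rfl
  have hw : ∀ v : AlgPoints V ℂ, ∃ w : AlgPoints W ℂ,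
      AlgPoints.map (L := ℂ) j w = AlgPoints.map D.q.hom.hom.hom (AlgPoints.map (L := ℂ) ι v) := by
    intro v
    refine ⟨Over.homMk (v.left ≫ f.toImage) ?_, ?_⟩
    · change (v.left ≫ f.toImage) ≫ f.imageι ≫ D.Y.X.hom = (specOver ℂ ℂ).hom
      rw [Category.assoc, Scheme.Hom.toImage_imageι_assoc, hf, Category.assoc, hqY, Over.w ι, Over.w v]
    · ext1
      change (v.left ≫ f.toImage) ≫ f.imageι = ((v ≫ ι) ≫ D.q.hom.hom.hom).left
      rw [Category.assoc, Scheme.Hom.toImage_imageι, Over.comp_left, Over.comp_left, hf, Category.assoc]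
  refine ⟨W, j, ?_, ?_, ?_⟩
  · -- `j = im(ι ≫ q) ↪ Y` is a closed immersion
    change IsClosedImmersion f.imageι
    infer_instance
  · -- `W(ℂ) ≠ Y(ℂ)`
    intro hWuniv
    apply hV
    have hsurjW : Function.Surjective f.imageι := by
      haveI : JacobsonSpace D.Y.X.left := LocallyOfFiniteType.jacobsonSpace D.Y.X.hom
      -- every closed point of `Y` is (the point of) a `ℂ`-point, which factors through `j`
      have hcl : closedPoints D.Y.X.left ⊆ Set.range f.imageι := by
        intro y hy
        obtain ⟨w, hw⟩ := (Set.range_eq_univ.1 hWuniv) ((ComplexPoints.equivClosedPoints D.Y.X).symm ⟨y, hy⟩)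
        refine ⟨w.pt, ?_⟩
        have hpt := congrArg AlgPoints.pt hw
        rw [AlgPoints.pt_map, ComplexPoints.pt_equivClosedPoints_symm_apply] at hpt
        exact hpt
      have hZ : IsClosed (Set.range f.imageι) := f.imageι.isClosedEmbedding.isClosed_range
      rw [← Set.range_eq_univ]
      refine Set.eq_univ_of_univ_subset ?_
      rw [← closure_closedPoints (X := D.Y.X.left)]
      exact closure_minimal hcl hZ
    have hsurjι : Function.Surjective ι.left := surjective_of_surjective_imageι_comp ι.left (Hom.toSchemeHom D.q) hsurjW
    haveI : Surjective ι.left := ⟨hsurjι⟩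
    haveI : IsIso ι.left := isIso_of_isClosedImmersion_of_surjective ι.left
    refine Set.eq_univ_of_forall fun p => ⟨Over.homMk (p.left ≫ inv ι.left) ?_, ?_⟩
    · change (p.left ≫ inv ι.left) ≫ V.hom = (specOver ℂ ℂ).hom
      rw [Category.assoc, show inv ι.left ≫ V.hom = D.P.X.hom by rw [IsIso.inv_comp_eq, Over.w ι], Over.w p]
    · ext1
      change (p.left ≫ inv ι.left) ≫ ι.left = p.left
      rw [Category.assoc, IsIso.inv_hom_id, Category.comp_id]
  · -- `J(E•) ⊆ {1} ∪ W(ℂ)`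
    intro y hy
    obtain ⟨p, rfl⟩ := pointsMap_surjective D.q D.isIsogeny_q.1 y
    rw [pointsMap_apply] at hy ⊢
    rcases hconf p hy with rfl | ⟨v, rfl⟩
    · left
      rw [Set.mem_singleton_iff, ← pointsMap_apply, map_one]
    · right
      exact hw v

end NowhereDisplaceable

end Summit.HodgeConjecture.HodgeConjecture.Ring2.SemiregularRepresentatives
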